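import Summits.Ventures.LatticeQCDFlow.Scaling.DefectSpecificHeatCeilingTwoDim
import Summits.Ventures.LatticeQCDFlow.Scaling.LeCamSwapFloor

/-!
HONEST FRAMING: exact (Metropolis-corrected) sampling algorithms for lattice gauge theory; figures
of merit are autocorrelation/cost numbers at stated couplings and volumes; no continuum-physics
claim.

# DefectSwapAcceptanceTwoDim — BOUNDARY-CONDITION TEMPERING (PTBC) IN TWO DIMENSIONS IS TWO-SIDED: THE SWAP
# ACCEPTANCE BETWEEN DEFECT COUPLINGS `u < u'` IS `≥ ½·exp(−N²e^{2N|β|}#D·(u'−u)²/2)` AND A DEFECT-COUPLING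
# LADDER WITH ADJACENT RATES `≥ α` NEEDS AND MAKES DO WITH `Θ((c_K − c_0)·√#D)` REPLICAS — EVERY COMPACT GAUGE
# GROUP, EVERY BULK COUPLING, EVERY `L ≥ 2` (lean-2 GEN-12, ours)

Venture-side (OURS).  Cell `lqcd-flow` (pub-lqcd), unit `pub-lqcd-lean-2-g12`, 2026-08-23.  Docking of the
two-dimensional defect specific-heat ceiling `Var_{μ_{β,u}}(S_D) ≤ M := N²e^{2N|β|}#D`
(`Scaling/DefectSpecificHeatCeilingTwoDim.defect_ceiling_family_twoDim`) into GEN-11's abstract laws under a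
ceiling (`swapAcc_ge_exp_neg_ceiling`, `ladder_sufficient'` of `SwapAcceptanceLadder`; `swapAcc_ge_half_exp_neg_ceiling`
of `LeCamSwapFloor`) for the defect family of `Scaling/DefectSwapAcceptance` (`ν_β = dU.tilted(−βS_{Dᶜ})`,
`X = −S_D`):

* `sqrt_defectCeiling_twoDim` — `√M = N·e^{N|β|}·√#D`;
* **`defect_swapAcc_ge_twoDim`** — `swapAcc(u,u') ≥ exp(−((u'−u)√(2M) + M(u'−u)²))` (`u ≤ u'`, `Dᶜ ≠ ∅`);
* **`defect_swapAcc_ge_half_twoDim`** — `swapAcc(u,u') ≥ ½·exp(−M(u'−u)²/2)`: with GEN-11's ceiling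
  `defect_swapAcc_le` the PTBC swap acceptance in `d = 2` is a Gaussian in `(u'−u)·√#D` from both sides;
* **`defect_ladder_sufficient_twoDim`** — the uniform defect-coupling ladder `a + jδ` with `δ·N·e^{N|β|}·√#D ≤ 1`
  and `3δ·N·e^{N|β|}·√#D ≤ log(1/α)` has every adjacent swap rate `≥ α`:
  `⌈(c_K − c_0)·N·e^{N|β|}·√#D·max(1, 3/log(1/α))⌉` replicas SUFFICE; with GEN-11's `defect_ladder_necessary`
  (`Ω((c_K − c_0)·√#D)`): **`Θ((c_K − c_0)·√#D)` PTBC REPLICAS IN TWO DIMENSIONS.**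

Reading (no numerics implied): for a line defect of `#D = L` plaquettes on `(ℤ/L)²` — the two-dimensional
analogue of the boundary-condition defect of Hasenbusch 2017 / Bonanno–Bonati–D'Elia 2021 — tempering from
open (`u = 0`) to periodic (`u = β`) needs `Θ(β·√L)` replicas per unit `log(1/α)`, two-sided, at every bulk
coupling.  NOT CLAIMED: `d ≥ 3`; sharp constants; round-trip / autocorrelation times; anything numerical about
published PTBC runs.  Literature grade: KNOWN MECHANISM, NEW TYPING; nothing is cited as a fact.
-/

noncomputable section

open MeasureTheory ProbabilityTheory Real Set
open Literature.MathematicalPhysics.QuantumFieldTheory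

namespace Summit.Ventures.LatticeQCDFlow.Scaling

section DefectTwoDim

variable {L N : ℕ} [NeZero L] {G : Type*} [Group G] [TopologicalSpace G] [IsTopologicalGroup G]
  [CompactSpace G] [MeasurableSpace G] [BorelSpace G] [SecondCountableTopology G]
  (ρ : G →* Matrix (Fin N) (Fin N) ℂ)

/-! ## §3 PTBC in two dimensions: two-sided -/

omit [NeZero L] [Group G] [TopologicalSpace G] [IsTopologicalGroup G] [CompactSpace G] [MeasurableSpace G]
  [BorelSpace G] [SecondCountableTopology G] in
/-- `√(N²·e^{2N|β|}·#D) = N·e^{N|β|}·√#D`. [folklore] -/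
theorem sqrt_defectCeiling_twoDim (β : ℝ) (D : Finset (Plaquette 2 L)) :
    sqrt ((N : ℝ) ^ 2 * exp (2 * N * |β|) * D.card) = N * exp (N * |β|) * sqrt D.card := by
  rw [show 2 * (N : ℝ) * |β| = N * |β| + N * |β| by ring, exp_add,
    show (N : ℝ) ^ 2 * (exp (N * |β|) * exp (N * |β|)) * D.card = (N * exp (N * |β|)) ^ 2 * D.card by ring,
    sqrt_mul (sq_nonneg _), sqrt_sq (by positivity)]

/-- **PTBC SWAP FLOOR IN TWO DIMENSIONS** (`u ≤ u'`, `Dᶜ` nonempty):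
`swapAcc (−S_D) ν_β u u' ≥ exp(−((u'−u)·√(2M) + M(u'−u)²))`, `M = N²e^{2N|β|}#D`. [ours] -/
theorem defect_swapAcc_ge_twoDim (hL : 2 ≤ L) (hρ : Continuous ρ) (β : ℝ) {u u' : ℝ} (huu' : u ≤ u')
    (D : Finset (Plaquette 2 L)) (hD : Dᶜ.Nonempty) :
    exp (-((u' - u) * sqrt (2 * ((N : ℝ) ^ 2 * exp (2 * N * |β|) * D.card)) +
        (N : ℝ) ^ 2 * exp (2 * N * |β|) * D.card * (u' - u) ^ 2)) ≤
    swapAcc (fun U : GaugeConfig 2 L G =>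
        -(∑ p ∈ D, ((N : ℝ) - (ρ (plaquetteHolonomy U p.1 p.2.1.1 p.2.1.2)).trace.re)))
      ((Measure.pi fun _ : Edge 2 L => haarProbability G).tilted fun U =>
        -(β * ∑ p ∈ Dᶜ, ((N : ℝ) - (ρ (plaquetteHolonomy U p.1 p.2.1.1 p.2.1.2)).trace.re))) u u' := by
  haveI := isProbabilityMeasure_defectBase (d := 2) (L := L) ρ hρ β D
  exact swapAcc_ge_exp_neg_ceiling (measurable_neg_defectSum ρ hρ D)
    (neg_defectSum_bounded ρ hρ D) huu' fun v _ => defect_ceiling_family_twoDim ρ hL hρ β v D hD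

/-- **GAUSSIAN PTBC SWAP FLOOR IN TWO DIMENSIONS** (Le Cam; `u ≤ u'`, `Dᶜ` nonempty):
`swapAcc (−S_D) ν_β u u' ≥ ½·exp(−N²e^{2N|β|}#D·(u'−u)²/2)` — with GEN-11's ceiling `defect_swapAcc_le` the PTBC
swap acceptance in `d = 2` is a Gaussian in `(u'−u)·√#D` from both sides. [ours] -/
theorem defect_swapAcc_ge_half_twoDim (hL : 2 ≤ L) (hρ : Continuous ρ) (β : ℝ) {u u' : ℝ} (huu' : u ≤ u')
    (D : Finset (Plaquette 2 L)) (hD : Dᶜ.Nonempty) :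
    exp (-((N : ℝ) ^ 2 * exp (2 * N * |β|) * D.card * (u' - u) ^ 2 / 2)) / 2 ≤
    swapAcc (fun U : GaugeConfig 2 L G =>
        -(∑ p ∈ D, ((N : ℝ) - (ρ (plaquetteHolonomy U p.1 p.2.1.1 p.2.1.2)).trace.re)))
      ((Measure.pi fun _ : Edge 2 L => haarProbability G).tilted fun U =>
        -(β * ∑ p ∈ Dᶜ, ((N : ℝ) - (ρ (plaquetteHolonomy U p.1 p.2.1.1 p.2.1.2)).trace.re))) u u' := by
  haveI := isProbabilityMeasure_defectBase (d := 2) (L := L) ρ hρ β D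
  exact swapAcc_ge_half_exp_neg_ceiling (measurable_neg_defectSum ρ hρ D)
    (neg_defectSum_bounded ρ hρ D) huu' fun v _ => defect_ceiling_family_twoDim ρ hL hρ β v D hD

/-- **PTBC LADDER SUFFICIENCY IN TWO DIMENSIONS**: at bulk coupling `β`, the uniform defect-coupling ladder
`a + jδ`, `j ≤ K` (`δ ≥ 0`) with `δ·N·e^{N|β|}·√#D ≤ 1` and `3·δ·N·e^{N|β|}·√#D ≤ log(1/α)` has every adjacent
PTBC swap rate `≥ α`: **`⌈(c_K − c_0)·N·e^{N|β|}·√#D·max(1, 3/log(1/α))⌉` replicas SUFFICE** — with GEN-11's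
`defect_ladder_necessary` (`Ω((c_K − c_0)·√#D)`), `Θ((c_K − c_0)·√#D)` PTBC replicas in two dimensions,
every compact gauge group, every bulk coupling, every `L ≥ 2`. [ours] -/
theorem defect_ladder_sufficient_twoDim (hL : 2 ≤ L) (hρ : Continuous ρ) (β : ℝ)
    (D : Finset (Plaquette 2 L)) (hD : Dᶜ.Nonempty) {a δ α : ℝ} (hδ : 0 ≤ δ) {K : ℕ}
    (hu1 : δ * ((N : ℝ) * exp (N * |β|) * sqrt D.card) ≤ 1)
    (hu2 : 3 * (δ * ((N : ℝ) * exp (N * |β|) * sqrt D.card)) ≤ log (1 / α)) (hα : 0 < α) :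
    ∀ j < K, α ≤ swapAcc (fun U : GaugeConfig 2 L G =>
        -(∑ p ∈ D, ((N : ℝ) - (ρ (plaquetteHolonomy U p.1 p.2.1.1 p.2.1.2)).trace.re)))
      ((Measure.pi fun _ : Edge 2 L => haarProbability G).tilted fun U =>
        -(β * ∑ p ∈ Dᶜ, ((N : ℝ) - (ρ (plaquetteHolonomy U p.1 p.2.1.1 p.2.1.2)).trace.re)))
      (a + j * δ) (a + (j + 1) * δ) := by
  haveI := isProbabilityMeasure_defectBase (d := 2) (L := L) ρ hρ β D
  refine ladder_sufficient' (measurable_neg_defectSum ρ hρ D) (neg_defectSum_bounded ρ hρ D)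
    hδ (M := (N : ℝ) ^ 2 * exp (2 * N * |β|) * D.card) (by positivity) (K := K)
    (fun v _ => defect_ceiling_family_twoDim ρ hL hρ β v D hD) ?_ ?_ hα
  · rwa [sqrt_defectCeiling_twoDim]
  · rwa [sqrt_defectCeiling_twoDim]

end DefectTwoDim

end Summit.Ventures.LatticeQCDFlow.Scaling

end
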